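import Mathlib
import Summits.ValiantsHypothesis.ValiantsHypothesis.Theorems.ValuativeGCTValuativeFlipPencilBorder
import Summits.ValiantsHypothesis.ValiantsHypothesis.Theorems.ValuativeGCTValuativeFlipPencilBorderGradedSecond

/-!
# The graded bordering bound: `s([[M,u],[vᵀ,c·y₄]]) ≥ s(M) + r(M|_{y₄=0}, u, v)`
# (crux `ValuativeGCT.ValuativeFlip`, stmt-ValiantsHypothesis-12624; wall-breaker axis k8 gen 1)

Helper file (`--supports stmt-ValiantsHypothesis-12624`), line `four-row-count`, `m`-free heart `H` of
`stub_fourRowPencilRank`.  When the corner of the border is a multiple of the LAST variable `y₄` the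
bordering transfer `pencilRank_border_transfer` (`…PencilBorder`) becomes additive: restricting to
`y₄ = 0` kills `y₄ · V(M)` and sends the new generators to the three-variable family
`{y_s · per B, y_s · Σ_l v_l Per_{kl}(B), y_s · Σ_k u_k Per_{kl}(B) : s < 3}` of the restricted pencil
`B = M|_{y₄ = 0}` (`pencilRank_border_graded`), so
  `s(M') ≥ s(M) + r(B, u|, v|)`,   `r` = the rank of that `(6(n+1)+3)`-element family.
Numerically `r = 6(n+1) + 2` for random nested zero-diagonal patterns (seat folder `compute/graded.c`,
sizes 7…22, exact ranks mod `2⁶¹-1`): iterating gives `s ≥ 3n² - O(n)`, above the line's threshold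
`2(6n/5)² + 6n/5 + 2 ≈ 2.88n²` — the chain is `…PencilBorderChain`.
Tool: `pb_finrank_add_finrank_map_le` (`dim W + dim ρ(New) ≤ dim (W + New)` when `ρ(W) = 0`).
[this crux, line four-row-count; folklore]
-/

set_option linter.dupNamespace false

namespace Summit.ValiantsHypothesis.ValiantsHypothesis.Theorems.ValuativeFlip

open scoped BigOperators Matrix
open MvPolynomial Literature.Computability.AlgebraicComplexity

/-- **Abstract form of the graded bound.**  With `f` injective and killed by `ρ`:
`finrank V + finrank R ≤ finrank (f V ⊔ S₂ ⊔ S₃ ⊔ S₄)` as soon as `R ⊆ ρ (S₂ ⊔ S₃ ⊔ S₄)`.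
[folklore] -/
theorem pb_graded_core {K E E' : Type*} [Field K] [AddCommGroup E] [Module K E]
    [AddCommGroup E'] [Module K E'] (ρ : E →ₗ[K] E') (f : E →ₗ[K] E) (hf : Function.Injective f)
    (hρf : ∀ x, ρ (f x) = 0) (V S₂ S₃ S₄ : Submodule K E) (R : Submodule K E')
    (hV : Module.Finite K ↥V) (h₂ : Module.Finite K ↥S₂) (h₃ : Module.Finite K ↥S₃)
    (h₄ : Module.Finite K ↥S₄) (hR : R ≤ (S₂ ⊔ (S₃ ⊔ S₄)).map ρ) :
    Module.finrank K ↥V + Module.finrank K ↥R ≤ Module.finrank K ↥(V.map f ⊔ S₂ ⊔ S₃ ⊔ S₄) := by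
  haveI := hV; haveI := h₂; haveI := h₃; haveI := h₄
  have hW : V.map f ≤ LinearMap.ker ρ := by
    rintro _ ⟨x, -, rfl⟩
    exact hρf x
  have h1 := pb_finrank_add_finrank_map_le ρ (V.map f) (S₂ ⊔ (S₃ ⊔ S₄)) hW
  have h2 : Module.finrank K ↥(V.map f) = Module.finrank K ↥V :=
    (LinearEquiv.finrank_eq (Submodule.equivMapOfInjective f hf V)).symm
  have h3 : Module.finrank K ↥R ≤ Module.finrank K ↥((S₂ ⊔ (S₃ ⊔ S₄)).map ρ) :=
    Submodule.finrank_mono hR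
  have h4 : V.map f ⊔ S₂ ⊔ S₃ ⊔ S₄ = V.map f ⊔ (S₂ ⊔ (S₃ ⊔ S₄)) := by rw [sup_assoc, sup_assoc]
  rw [h4]
  omega

/-- **Graded bordering bound.**  Border a four-variable pencil `M` of size `n + 1` by forms `u, v`
and a corner `c · y₄` (`y₄ = X (Fin.last 3)`).  For some `c ≠ 0` the bordered pencil `M'` (extending
`M`) satisfies `s(M') ≥ s(M) + r`, where `r` is the dimension of the span of the three-variable family
`{y_s · per B, y_s · Σ_l v_l|·(∂_{kl} per)(B), y_s · Σ_k u_k|·(∂_{kl} per)(B) : s < 3, k, l ≤ n}` of the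
restricted pencil `B = M|_{y₄ = 0}` (`B ij s = M ij (castSucc s)`) and restricted border forms.
[this crux, line four-row-count; folklore] -/
theorem pencilRank_border_graded (n : ℕ) (M : Fin (n + 1) × Fin (n + 1) → Fin 4 → ℂ)
    (u v : Fin (n + 1) → Fin 4 → ℂ) :
    ∃ (c : ℂ) (M' : Fin (n + 2) × Fin (n + 2) → Fin 4 → ℂ), c ≠ 0 ∧
      (∀ i j, M' (Fin.castSucc i, Fin.castSucc j) = M (i, j)) ∧
      (∀ i, M' (Fin.castSucc i, Fin.last (n + 1)) = u i) ∧
      (∀ j, M' (Fin.last (n + 1), Fin.castSucc j) = v j) ∧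
      M' (Fin.last (n + 1), Fin.last (n + 1)) = Pi.single (Fin.last 3) c ∧
      Module.finrank ℂ ↥(Submodule.span ℂ (Set.range fun tc : Fin 4 × (Fin (n + 1) × Fin (n + 1)) =>
          (X tc.1 : MvPolynomial (Fin 4) ℂ) *
            aeval (fun ij : Fin (n + 1) × Fin (n + 1) => ∑ t : Fin 4, M ij t • (X t : MvPolynomial (Fin 4) ℂ))
              (pderiv tc.2 (perPoly (Fin (n + 1)) ℂ)))) +
      Module.finrank ℂ ↥(
        Submodule.span ℂ (Set.range fun s : Fin 3 =>
          (X s : MvPolynomial (Fin 3) ℂ) *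
            aeval (fun ij : Fin (n + 1) × Fin (n + 1) => ∑ s : Fin 3, M ij (Fin.castSucc s) • (X s : MvPolynomial (Fin 3) ℂ))
              (perPoly (Fin (n + 1)) ℂ))
        ⊔ Submodule.span ℂ (Set.range fun sk : Fin 3 × Fin (n + 1) =>
          (X sk.1 : MvPolynomial (Fin 3) ℂ) *
            ∑ l : Fin (n + 1), (∑ s : Fin 3, v l (Fin.castSucc s) • (X s : MvPolynomial (Fin 3) ℂ)) *
              aeval (fun ij : Fin (n + 1) × Fin (n + 1) => ∑ s : Fin 3, M ij (Fin.castSucc s) • (X s : MvPolynomial (Fin 3) ℂ))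
                (pderiv (sk.2, l) (perPoly (Fin (n + 1)) ℂ)))
        ⊔ Submodule.span ℂ (Set.range fun sl : Fin 3 × Fin (n + 1) =>
          (X sl.1 : MvPolynomial (Fin 3) ℂ) *
            ∑ k : Fin (n + 1), (∑ s : Fin 3, u k (Fin.castSucc s) • (X s : MvPolynomial (Fin 3) ℂ)) *
              aeval (fun ij : Fin (n + 1) × Fin (n + 1) => ∑ s : Fin 3, M ij (Fin.castSucc s) • (X s : MvPolynomial (Fin 3) ℂ))
                (pderiv (k, sl.2) (perPoly (Fin (n + 1)) ℂ)))) ≤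
      Module.finrank ℂ ↥(Submodule.span ℂ (Set.range fun tc : Fin 4 × (Fin (n + 2) × Fin (n + 2)) =>
          (X tc.1 : MvPolynomial (Fin 4) ℂ) *
            aeval (fun ij : Fin (n + 2) × Fin (n + 2) => ∑ t : Fin 4, M' ij t • (X t : MvPolynomial (Fin 4) ℂ))
              (pderiv tc.2 (perPoly (Fin (n + 2)) ℂ)))) := by
  classical
  obtain ⟨c, M', hc, h11, h12, h21, h22, hrank⟩ :=
    pencilRank_border_transfer n M u v (Pi.single (Fin.last 3) (1 : ℂ))
  refine ⟨c, M', hc, h11, h12, h21, ?_, le_trans ?_ hrank⟩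
  · rw [h22, ← Pi.single_smul', smul_eq_mul, mul_one]
  -- the corner form is `y₄`
  have hlw : (∑ t : Fin 4, (Pi.single (Fin.last 3) (1 : ℂ) : Fin 4 → ℂ) t • (X t : MvPolynomial (Fin 4) ℂ)) =
      X (Fin.last 3) := by
    rw [Finset.sum_eq_single (Fin.last 3)]
    · simp
    · intro t _ ht; rw [Pi.single_eq_of_ne ht, zero_smul]
    · intro h; exact absurd (Finset.mem_univ _) h
  rw [hlw]
  -- the restriction `y₄ ↦ 0`
  obtain ⟨ρ, hρc, hρl⟩ : ∃ ρ : MvPolynomial (Fin 4) ℂ →ₐ[ℂ] MvPolynomial (Fin 3) ℂ,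
      (∀ s : Fin 3, ρ (X (Fin.castSucc s)) = X s) ∧ ρ (X (Fin.last 3)) = 0 := by
    refine ⟨aeval (Fin.snoc (α := fun _ => MvPolynomial (Fin 3) ℂ)
      (fun s : Fin 3 => (X s : MvPolynomial (Fin 3) ℂ)) 0), fun s => ?_, ?_⟩
    · rw [aeval_X]; simp only [Fin.snoc_castSucc]
    · rw [aeval_X]; exact Fin.snoc_last _ _
  have hρlin : ∀ a : Fin 4 → ℂ, ρ (∑ t : Fin 4, a t • (X t : MvPolynomial (Fin 4) ℂ)) =
      ∑ s : Fin 3, a (Fin.castSucc s) • (X s : MvPolynomial (Fin 3) ℂ) := by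
    intro a
    rw [map_sum, Fin.sum_univ_castSucc]
    simp only [map_smul, hρc, hρl, smul_zero, add_zero]
  have hcomp : ρ.comp (aeval (fun ij : Fin (n + 1) × Fin (n + 1) => ∑ t : Fin 4, M ij t • (X t : MvPolynomial (Fin 4) ℂ))) =
      aeval (fun ij : Fin (n + 1) × Fin (n + 1) => ∑ s : Fin 3, M ij (Fin.castSucc s) • (X s : MvPolynomial (Fin 3) ℂ)) :=
    MvPolynomial.algHom_ext fun ij => by simp only [AlgHom.comp_apply, aeval_X, hρlin]
  have hρpen : ∀ P : MvPolynomial (Fin (n + 1) × Fin (n + 1)) ℂ,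
      ρ (aeval (fun ij : Fin (n + 1) × Fin (n + 1) => ∑ t : Fin 4, M ij t • (X t : MvPolynomial (Fin 4) ℂ)) P) =
        aeval (fun ij : Fin (n + 1) × Fin (n + 1) => ∑ s : Fin 3, M ij (Fin.castSucc s) • (X s : MvPolynomial (Fin 3) ℂ)) P := by
    intro P
    rw [← AlgHom.comp_apply, hcomp]
  -- assemble
  refine pb_graded_core ρ.toLinearMap (LinearMap.mulLeft ℂ (X (Fin.last 3) : MvPolynomial (Fin 4) ℂ))
    (mul_right_injective₀ (X_ne_zero _)) (fun x => ?_) _ _ _ _ _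
    (Module.Finite.span_of_finite ℂ (Set.finite_range _)) (Module.Finite.span_of_finite ℂ (Set.finite_range _))
    (Module.Finite.span_of_finite ℂ (Set.finite_range _)) (Module.Finite.span_of_finite ℂ (Set.finite_range _)) ?_
  · simp only [AlgHom.toLinearMap_apply, LinearMap.mulLeft_apply, map_mul, hρl, zero_mul]
  refine sup_le (sup_le ?_ ?_) ?_
  · rw [Submodule.span_le]
    rintro _ ⟨s, rfl⟩
    refine ⟨(X (Fin.castSucc s) : MvPolynomial (Fin 4) ℂ) *
      aeval (fun ij : Fin (n + 1) × Fin (n + 1) => ∑ t : Fin 4, M ij t • (X t : MvPolynomial (Fin 4) ℂ))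
        (perPoly (Fin (n + 1)) ℂ), ?_, ?_⟩
    · exact Submodule.mem_sup_left (Submodule.subset_span ⟨Fin.castSucc s, rfl⟩)
    · simp only [AlgHom.toLinearMap_apply, map_mul, hρc, hρpen]
  · rw [Submodule.span_le]
    rintro _ ⟨⟨s, k⟩, rfl⟩
    refine ⟨(X (Fin.castSucc s) : MvPolynomial (Fin 4) ℂ) *
      ∑ l : Fin (n + 1), (∑ t : Fin 4, v l t • (X t : MvPolynomial (Fin 4) ℂ)) *
        aeval (fun ij : Fin (n + 1) × Fin (n + 1) => ∑ t : Fin 4, M ij t • (X t : MvPolynomial (Fin 4) ℂ))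
          (pderiv (k, l) (perPoly (Fin (n + 1)) ℂ)), ?_, ?_⟩
    · exact Submodule.mem_sup_right (Submodule.mem_sup_left (Submodule.subset_span ⟨(Fin.castSucc s, k), rfl⟩))
    · simp only [AlgHom.toLinearMap_apply, map_mul, map_sum, hρc, hρlin, hρpen]
  · rw [Submodule.span_le]
    rintro _ ⟨⟨s, l⟩, rfl⟩
    refine ⟨(X (Fin.castSucc s) : MvPolynomial (Fin 4) ℂ) *
      ∑ k : Fin (n + 1), (∑ t : Fin 4, u k t • (X t : MvPolynomial (Fin 4) ℂ)) *
        aeval (fun ij : Fin (n + 1) × Fin (n + 1) => ∑ t : Fin 4, M ij t • (X t : MvPolynomial (Fin 4) ℂ))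
          (pderiv (k, l) (perPoly (Fin (n + 1)) ℂ)), ?_, ?_⟩
    · exact Submodule.mem_sup_right (Submodule.mem_sup_right (Submodule.subset_span ⟨(Fin.castSucc s, l), rfl⟩))
    · simp only [AlgHom.toLinearMap_apply, map_mul, map_sum, hρc, hρlin, hρpen]

end Summit.ValiantsHypothesis.ValiantsHypothesis.Theorems.ValuativeFlip
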